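import Literature.LinearAlgebra.TensorNetworks.QTTShiftCirculant
import Literature.LinearAlgebra.TensorNetworks.QTTLaplaceNeumannPeriodic
import Literature.LinearAlgebra.Matrix.CirculantDFT
import HarnessLib

/-!
# Explicit QTT representation of a circulant whose column is an exponential sum
(Vysotsky–Rakhuba 2022, Proposition 4.1 and Corollary 4.1)

Source: L. Vysotsky, M. Rakhuba, *Tensor rank bounds and explicit QTT representations for the
inverses of circulant matrices*, Numer. Linear Algebra Appl. 30(3) (2023) e2461, arXiv:2205.04335
[VysotskyRakhuba2022] (held text: `paper:arxiv-2205.04335`, §4 pp. 10–11, proof in the appendix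
§8 p. 19).  The blocks `I, J, J'` are those of [KazeevKhoromskij2012, eq. (7)]
(`Literature.LinearAlgebra.TensorNetworks.blkI/blkJ/blkJ'`, file `QTTLaplace`), `H = J + J'`
(`blkH`, file `QTTShiftCirculant`).

## The statements (verbatim, arXiv text p. 10–11)

"**Proposition 4.1.** Let `L > 2` and consider a circulant `B_L ∈ ℂ^{2^L × 2^L}` defined by its
first column `(B_L)_j = α_1 w_1^j + ⋯ + α_r w_r^j`, where `α_t, w_t ∈ ℂ`, `t = 1, …, r`, are given
constants.  Then `B_L` admits an explicit QTT representation with the ranks `(2, r+1, r+1, …, r+1)`: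
`B_L = Q_1 ⋈ Q_2 ⋈ ⋯ ⋈ Q_L`, where
`Q_1 = [I H]`, `Q_2 = [I K_{1,2} ⋯ K_{r,2}; · M_{1,2} ⋯ M_{r,2}]`,
`Q_k = [I K_{1,k} ⋯ K_{r,k}; · M_{1,k}; ⋱ ; · M_{r,k}]`, `k = 3, …, L−1`,
`Q_L = [(Σ_t α_t) I + (Σ_t α_t w_t) J' + (Σ_t α_t w_t^{2^L−1}) J; α_1 w_1 M_{1,L}; ⋯;
α_r w_r M_{r,L}]` and where for all `t = 1, …, r`, `k = 1, …, L`: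
`K_{t,k} = J' + q_{t,k}^{2^k−2} J`, `M_{t,k} = q_{t,k} I + q_{t,k}² J' + J`,
`q_{t,k} = w_t^{2^{L−k}}`."

"**Corollary 4.1.** Let `L > 2` and consider a circulant `B_L ∈ ℂ^{2^L × 2^L}` defined by its first
column `(B_L)_j = α_1 w_1^j + ⋯ + α_{r_1} w_{r_1}^j + β_1 z_1^{2^L−j} + ⋯ + β_{r_2} z_{r_2}^{2^L−j}`
…
Then `B_L` admits an explicit QTT representation with the ranks
`(2, r_1+r_2+1, r_1+r_2+1, …, r_1+r_2+1)`: `B_L = Q_1 ⋈ Q_2 ⋈ ⋯ ⋈ Q_L`" with the same `Q_1`,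
the cores `Q_k` carrying the additional first-row blocks `K̄_{1,k}, …, K̄_{r_2,k}` and diagonal
blocks `M̄_{1,k}, …, M̄_{r_2,k}`,
"`Q_L = [γ_1 I + γ_2 J' + γ_3 J; α_1 w_1 M_{1,L}; ⋯; α_{r_1} w_{r_1} M_{r_1,L}; β_1 z_1 M̄_{1,L}; ⋯;
β_{r_2} z_{r_2} M̄_{r_2,L}]` and where … `K̄_{t,k} = q̄_{t,k}² J' + J`,
`M̄_{t,k} = q̄_{t,k} I + J' + q̄_{t,k}² J`, `q̄_{t,k} = z_t^{2^{L−k}}`,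
`γ_1 = Σ_{t=1}^{r_1} α_t + Σ_{t=1}^{r_2} β_t z_t^{2^L}`,
`γ_2 = Σ α_t w_t + Σ β_t z_t^{2^L−1}`, `γ_3 = Σ α_t w_t^{2^L−1} + Σ β_t z_t`."

## A misprint in Corollary 4.1 (recorded, and repaired from the paper's own proof)

Multiplying the printed cores out in exact rational arithmetic (strong Kronecker products, random
rational data) reproduces the circulant of Proposition 4.1 exactly (`L = 3, 4, 5`, `r = 1, 2`), and
the circulant of Corollary 4.1 exactly for `L = 3` — but NOT for `L = 4, 5` as soon as `r_2 ≥ 1`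
(e.g. `L = 4`, `r_1 = 0`, `r_2 = 1`: maximal entry defect `45.9` for the sampled data).  The
paper's proof of the corollary (p. 11) derives `K̄_{t,k} = K'_{t,k} · z_t^{2^L − 2^{L−k+1}}` with
`K'_{t,k} = J' + z_t^{−2^L + 2^{L−k+1}} J`, i.e.
`K̄_{t,k} = z_t^{2^L − 2^{L−k+1}} J' + J = q̄_{t,k}^{2^k − 2} J' + J`
(the mirror image of `K_{t,k}`); the displayed `q̄_{t,k}²` agrees with this only at `k = 2` — the
only interior level when `L = 3`.  With `K̄_{t,k} = q̄_{t,k}^{2^k−2} J' + J` (`esKbar` below) the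
representation is exact in all sampled cases and is PROVED below for every `L`; the printed block is
kept as `esKbarPrinted` with the reconciliation `esKbar_two` (`k = 2`).  We hold only the arXiv
text; whether the journal version carries the same display was not checked.

## What is proved here (all `L ≥ 0`, any commutative ring; the paper assumes `L > 2`, `ℂ`)

Both statements are rendered by ONE uniform train `expSumTrain K c w rv L` on the digit pairs
`Fin 2 × Fin 2`, bond dimension `r + 1`, with a Boolean flag `rv t` per term selecting the
orientation (`w_t^j`, flag `false`, blocks `K, M`; or `w_t^{2^L − j}`, flag `true`, blocks
`K̄, M̄`):
* cores `expSumCore` (site `ℓ`, level `k = ℓ + 1`): first row `[I, K_{1,k}, …]` (`K̄` for flagged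
  terms), diagonal `M_{t,k}` (`M̄`), zero elsewhere — the displayed `Q_k`; left boundary `e_0`, so
  that the first core acts as its first row `[I H ⋯ H]` (`lbdry_vecMul_expSumCore_zero`:
  `K_{t,1} = K̄_{t,1} = H`), which is the paper's `Q_1 = [I H]` joined to the selector
  `[1 0 ⋯ 0; 0 1 ⋯ 1]` (whose product with `expSumCore 1` is the displayed two-row `Q_2`,
  `selector_vecMul_expSumCore`); right boundary `expSumBdry = (γ_1; α_t w_t; β_t z_t)`, so
  that the last core times the boundary is the displayed column `Q_L`
  (`expSumCore_mulVec_expSumBdry`);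
* `qttMatrix_expSumTrain`: the represented matrix is the circulant with first column
  `j ↦ Σ_t c_t w_t^{j}` resp. `w_t^{2^L − j}` — Proposition 4.1 (`qttMatrix_expSumTrain_prop41`) and
  Corollary 4.1 (`qttMatrix_expSumTrain_cor41`, families joined by `Fin.append`);
* ranks: all bond dimensions are `r + 1` (`r_expSumTrain`) and the first unfolding has rank `≤ 2`
  (`rank_unfolding_expSumTrain_first_le`) — the paper's `(2, r+1, …, r+1)`.
The proof is NOT the paper's (which reduces the rank-`2r` representation obtained from Lemma 4.2 by
polylinearity, §8): it is the transfer-matrix bookkeeping `expSumState_step` — after `k` levels the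
bond vector is `(𝟙[m = n]; 𝟙[m ≠ n] w_t^{2^{L−k}((m−n) mod 2^k − 1)})_t` in the prefix values
`m, n` (digits swapped for flagged terms), generic lemma `vecMul_chainProd_of_digitStep'`
(position-dependent version of `vecMul_chainProd_of_digitStep`, file `QTTLaplace`).

Also recorded (dedup bridge): the cyclic permutation matrix `cyclicShiftP` of file
`QTTShiftCirculant` is the transpose of the directed-cycle adjacency matrix `cycShift` of
`Literature.Combinatorics.SimpleGraph` (file `CycleSpectrum`), `cyclicShiftP_eq_transpose_cycShift`.
-/

open Matrix

universe u

namespace Literature.LinearAlgebra.TensorNetworks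

namespace TensorTrain

variable {K : Type u} [CommSemiring K] {b : ℕ}

/-- DIGIT-STEP LEMMA with position-dependent cores: if the bond-vector family `F k m m'` satisfies
`F (k+1) (b m + a) (b m' + a') = F k m m' · W_k(a, a')` for all prefix values `m, m' < b^k`,
`k < R`, then `F 0 0 0 · W_0(σ_0, μ_0) ⋯ W_{R−1}(σ_{R−1}, μ_{R−1}) = F R m n` at the encoded
indices (bookkeeping; the position-independent case is `vecMul_chainProd_of_digitStep`).
[cite: VysotskyRakhuba2022, §8 (proof of Prop. 4.1)] -/
theorem vecMul_chainProd_of_digitStep' {n : ℕ} (W : ℕ → Fin b × Fin b → Matrix (Fin n) (Fin n) K)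
    (F : ℕ → ℕ → ℕ → Fin n → K) :
    ∀ (R : ℕ), (∀ (k m m' : ℕ) (a a' : Fin b), k < R → m < b ^ k → m' < b ^ k →
      F (k + 1) (b * m + a) (b * m' + a') = F k m m' ᵥ* W k (a, a')) →
    ∀ (σ μ : Fin R → Fin b),
      F 0 0 0 ᵥ* chainProd W R (fun r => (σ r, μ r)) =
        F R (quanticsEquiv b R σ) (quanticsEquiv b R μ)
  | 0, _, σ, μ => by simp [chainProd]
  | R + 1, hF, σ, μ => by
      have hσ : σ = Fin.snoc (α := fun _ => Fin b) (Fin.init σ) (σ (Fin.last R)) :=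
        (Fin.snoc_init_self σ).symm
      have hμ : μ = Fin.snoc (α := fun _ => Fin b) (Fin.init μ) (μ (Fin.last R)) :=
        (Fin.snoc_init_self μ).symm
      rw [chainProd, ← Matrix.vecMul_vecMul]
      have ih := vecMul_chainProd_of_digitStep' W F R
        (fun k m m' a a' hk => hF k m m' a a' (Nat.lt_succ_of_lt hk)) (Fin.init σ) (Fin.init μ)
      rw [show (fun r : Fin R => ((Fin.init σ : Fin R → Fin b) r, (Fin.init μ : Fin R → Fin b) r)) =
        Fin.init fun r : Fin (R + 1) => (σ r, μ r) from rfl] at ih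
      rw [ih]
      conv_rhs => rw [hσ, hμ]
      rw [val_quanticsEquiv_snoc, val_quanticsEquiv_snoc]
      exact (hF R _ _ _ _ (Nat.lt_succ_self R) (Fin.isLt _) (Fin.isLt _)).symm

end TensorTrain

/-! ## The cyclic distance `(m − n) mod P` without `%` -/

/-- `cycSub P m n = (m − n) mod P` for `m, n < P`, written with a case split (bookkeeping for the
circulant index `i − j` in `Fin P`).  [cite: VysotskyRakhuba2022, Prop. 4.1] -/
def cycSub (P m n : ℕ) : ℕ := if n ≤ m then m - n else m + P - n

/-- Subtraction in `Fin P` is the cyclic distance (bookkeeping).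
[cite: VysotskyRakhuba2022, Prop. 4.1] -/
theorem val_fin_sub_eq_cycSub {P : ℕ} (m n : Fin P) : ((m - n : Fin P) : ℕ) = cycSub P m n := by
  unfold cycSub
  split_ifs with h
  · exact Fin.coe_sub_iff_le.2 (Fin.le_def.2 h)
  · rw [Fin.coe_sub_iff_lt.2 (Fin.lt_def.2 (Nat.lt_of_not_le h))]
    omega

/-- [folklore] `cycSub P m m = 0`. -/
private theorem cycSub_self (P m : ℕ) : cycSub P m m = 0 := by
  simp [cycSub]

/-- [folklore] `1 ≤ cycSub P m n ≤ P − 1`-type bounds for `m ≠ n`, `m, n < P`. -/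
private theorem one_le_cycSub {P m n : ℕ} (h : m ≠ n) (hm : m < P) (hn : n < P) :
    1 ≤ cycSub P m n ∧ cycSub P m n < P := by
  unfold cycSub; split_ifs <;> omega

/-- [folklore] The cyclic distance of the swapped pair: `cycSub P n m = P − cycSub P m n`
(`m ≠ n`). -/
private theorem cycSub_swap {P m n : ℕ} (h : m ≠ n) (hm : m < P) (hn : n < P) :
    cycSub P n m = P - cycSub P m n := by
  unfold cycSub; split_ifs <;> omega

/-- [folklore] One more digit, distinct prefixes:
`cycSub (2P) (2m+a) (2n+a') = 2·cycSub P m n + a − a'`. -/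
private theorem cycSub_step {P m n a a' : ℕ} (h : m ≠ n) (hm : m < P) (hn : n < P) (ha : a ≤ 1)
    (ha' : a' ≤ 1) : cycSub (2 * P) (2 * m + a) (2 * n + a') = 2 * cycSub P m n + a - a' := by
  unfold cycSub; split_ifs <;> omega

/-- [folklore] One more digit, equal prefixes: `cycSub (2P) (2m+a) (2m+a') − 1 = (2P − 2)·a'` for
`a ≠ a'` binary digits (`(a, a') = (1, 0)`: distance `1`; `(0, 1)`: distance `2P − 1`), `0 < P`. -/
private theorem cycSub_step_same {P m a a' : ℕ} (hP : 0 < P) (ha : a ≤ 1) (ha' : a' ≤ 1)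
    (h : a ≠ a') : cycSub (2 * P) (2 * m + a) (2 * m + a') - 1 = (2 * P - 2) * a' := by
  unfold cycSub
  rcases Nat.le_one_iff_eq_zero_or_eq_one.1 ha' with rfl | rfl <;> split_ifs <;> omega

/-! ## The blocks of Proposition 4.1 / Corollary 4.1 -/

section Blocks

variable (K : Type u) [CommRing K]

/-- `K_{t,k} = J' + q_{t,k}^{2^k − 2} J` (as a function of `q = q_{t,k}` and the level `k`).
[cite: VysotskyRakhuba2022, Prop. 4.1] -/
def esK (q : K) (k : ℕ) (p : Fin 2 × Fin 2) : K := blkJ' K p + q ^ (2 ^ k - 2) * blkJ K p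

/-- `M_{t,k} = q_{t,k} I + q_{t,k}² J' + J`.  [cite: VysotskyRakhuba2022, Prop. 4.1] -/
def esM (q : K) (p : Fin 2 × Fin 2) : K := q * blkI K p + q ^ 2 * blkJ' K p + blkJ K p

/-- `K̄_{t,k} = q̄_{t,k}^{2^k − 2} J' + J` — the CORRECTED block (the paper's own derivation
`K̄_{t,k} = K'_{t,k} z_t^{2^L − 2^{L−k+1}}`, p. 11; the display prints the exponent `2`, see
`esKbarPrinted`, `esKbar_two` and the file header).  [cite: VysotskyRakhuba2022, Cor. 4.1] -/
def esKbar (q : K) (k : ℕ) (p : Fin 2 × Fin 2) : K := q ^ (2 ^ k - 2) * blkJ' K p + blkJ K p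

/-- `M̄_{t,k} = q̄_{t,k} I + J' + q̄_{t,k}² J`.  [cite: VysotskyRakhuba2022, Cor. 4.1] -/
def esMbar (q : K) (p : Fin 2 × Fin 2) : K := q * blkI K p + blkJ' K p + q ^ 2 * blkJ K p

/-- `K̄_{t,k} = q̄_{t,k}² J' + J` AS PRINTED in Cor. 4.1 (arXiv text) — a misprint for `esKbar`
except at `k = 2` (`esKbar_two`); see the file header.  [cite: VysotskyRakhuba2022, Cor. 4.1] -/
def esKbarPrinted (q : K) (p : Fin 2 × Fin 2) : K := q ^ 2 * blkJ' K p + blkJ K p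

variable {K}

/-- At the level `k = 2` the printed block is the corrected one (`2^2 − 2 = 2`); for `L = 3` this is
the only interior level, which is why the printed cores pass the `L = 3` check.
[cite: VysotskyRakhuba2022, Cor. 4.1] -/
theorem esKbar_two (q : K) (p : Fin 2 × Fin 2) : esKbar K q 2 p = esKbarPrinted K q p := by
  simp [esKbar, esKbarPrinted]

/-- … but from the level `k = 3` on the printed block disagrees with the paper's own identity
`K̄_{t,k} = K'_{t,k} q̄_{t,k}^{2^k − 2}` (= `esKbar`): e.g. `q̄ = 2`, `k = 3`, entry `(1, 0)` —
printed `2² = 4`, derived `2⁶ = 64` (kernel-checked instance of the misprint recorded in the file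
header).  [cite: VysotskyRakhuba2022, Cor. 4.1] -/
theorem esKbarPrinted_ne_esKbar_three : esKbarPrinted ℤ 2 (1, 0) ≠ esKbar ℤ 2 3 (1, 0) := by
  simp [esKbarPrinted, esKbar, blkJ, blkJ']

/-- `K̄` is the mirror image of `K`: `K̄_{t,k}(i, j) = K_{t,k}(j, i)` (with `q̄` for `q`).
[cite: VysotskyRakhuba2022, Cor. 4.1] -/
theorem esKbar_eq_esK_swap (q : K) (k : ℕ) (p : Fin 2 × Fin 2) :
    esKbar K q k p = esK K q k p.swap := by
  rcases p with ⟨i, j⟩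
  fin_cases i <;> fin_cases j <;> simp [esKbar, esK, blkJ, blkJ']

/-- `M̄` is the mirror image of `M`: `M̄_{t,k}(i, j) = M_{t,k}(j, i)`.
[cite: VysotskyRakhuba2022, Cor. 4.1] -/
theorem esMbar_eq_esM_swap (q : K) (p : Fin 2 × Fin 2) : esMbar K q p = esM K q p.swap := by
  rcases p with ⟨i, j⟩
  fin_cases i <;> fin_cases j <;> simp [esMbar, esM, blkI, blkJ, blkJ']

/-- The entries of `K_{t,k}`: `K(i, i) = 0`, `K(1, 0) = 1`, `K(0, 1) = q^{2^k−2}`; uniformly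
`K(i, j) = 𝟙[i ≠ j] q^{(2^k − 2)·j}` (bookkeeping).  [cite: VysotskyRakhuba2022, Prop. 4.1] -/
theorem esK_apply (q : K) (k : ℕ) (i j : Fin 2) :
    esK K q k (i, j) = if i = j then 0 else q ^ ((2 ^ k - 2) * (j : ℕ)) := by
  fin_cases i <;> fin_cases j <;> simp [esK, blkJ, blkJ']

/-- The entries of `M_{t,k}`: `M(0,0) = M(1,1) = q`, `M(1,0) = q²`, `M(0,1) = 1`; uniformly
`M(i, j) = q^{1 + i − j}` (bookkeeping).  [cite: VysotskyRakhuba2022, Prop. 4.1] -/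
theorem esM_apply (q : K) (i j : Fin 2) : esM K q (i, j) = q ^ (1 + (i : ℕ) - j) := by
  fin_cases i <;> fin_cases j <;> simp [esM, blkI, blkJ, blkJ']

/-- At the first level both `K_{t,1}` and `K̄_{t,1}` are `H = J + J'` (`2^1 − 2 = 0`), whence
`Q_1 = [I H]`.  [cite: VysotskyRakhuba2022, Prop. 4.1] -/
theorem esK_one (q : K) (p : Fin 2 × Fin 2) : esK K q 1 p = blkH K p := by
  simp [esK, blkH, add_comm]

/-- `K̄_{t,1} = H`.  [cite: VysotskyRakhuba2022, Cor. 4.1] -/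
theorem esKbar_one (q : K) (p : Fin 2 × Fin 2) : esKbar K q 1 p = blkH K p := by
  simp [esKbar, blkH, add_comm]

end Blocks

/-! ## The train -/

section Train

variable (K : Type u) [CommRing K] {r : ℕ}

/-- The first-row block of term `t` at level `k`: `K_{t,k}` (flag `false`) or `K̄_{t,k}` (flag
`true`), `q = q_{t,k}` resp. `q̄_{t,k}`.  [cite: VysotskyRakhuba2022, Cor. 4.1] -/
def esKflag (rv : Bool) (q : K) (k : ℕ) (p : Fin 2 × Fin 2) : K :=
  if rv then esKbar K q k p else esK K q k p

/-- The diagonal block of term `t`: `M_{t,k}` (flag `false`) or `M̄_{t,k}` (flag `true`).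
[cite: VysotskyRakhuba2022, Cor. 4.1] -/
def esMflag (rv : Bool) (q : K) (p : Fin 2 × Fin 2) : K :=
  if rv then esMbar K q p else esM K q p

/-- `q_{t,k} = w_t^{2^{L−k}}` (`q̄_{t,k} = z_t^{2^{L−k}}`), at the site `ℓ = k − 1`.
[cite: VysotskyRakhuba2022, Prop. 4.1] -/
def expSumQ (w : K) (L ℓ : ℕ) : K := w ^ 2 ^ (L - (ℓ + 1))

/-- THE CORE `Q_k` (`k = ℓ + 1`) of Prop. 4.1 / Cor. 4.1 as an `(r+1) × (r+1)` block matrix read at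
the digit pair `p = (i, j)`: first row `[I, K_{1,k}, …, K_{r,k}]` (`K̄` for flagged terms),
diagonal `M_{t,k}` (`M̄`), zeros elsewhere.  [cite: VysotskyRakhuba2022, Prop. 4.1] -/
def expSumCore (w : Fin r → K) (rv : Fin r → Bool) (L ℓ : ℕ) (p : Fin 2 × Fin 2) :
    Matrix (Fin (r + 1)) (Fin (r + 1)) K :=
  Matrix.of (vecCons (vecCons (blkI K p) fun t => esKflag K (rv t) (expSumQ K (w t) L ℓ) (ℓ + 1) p)
    fun t => vecCons 0 fun s => if t = s then esMflag K (rv t) (expSumQ K (w t) L ℓ) p else 0)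

/-- THE RIGHT BOUNDARY `(γ_1; α_1 w_1; …; β_1 z_1; …)` with
`γ_1 = Σ_t α_t + Σ_t β_t z_t^{2^L}` — the column `Q_L` is the last core times this vector
(`expSumCore_mulVec_expSumBdry`).  [cite: VysotskyRakhuba2022, Cor. 4.1] -/
def expSumBdry (c w : Fin r → K) (rv : Fin r → Bool) (L : ℕ) : Fin (r + 1) → K :=
  vecCons (∑ t, c t * w t ^ (if rv t then 2 ^ L else 0)) fun t => c t * w t

/-- THE TRAIN of Prop. 4.1 / Cor. 4.1: `L` sites, all bond dimensions `r + 1`, cores `expSumCore`,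
left boundary `e_0` (so the first core acts as `Q_1 = [I H]`), right boundary `expSumBdry`; term `t`
contributes `c_t w_t^j` (flag `false`) or `c_t w_t^{2^L − j}` (flag `true`) to the column.
[cite: VysotskyRakhuba2022, Prop. 4.1] -/
def expSumTrain (c w : Fin r → K) (rv : Fin r → Bool) (L : ℕ) :
    TensorTrain K (Fin 2 × Fin 2) L :=
  TensorTrain.uniform L (r + 1) (fun ℓ p => expSumCore K w rv L ℓ p) (Pi.single 0 1)
    (expSumBdry K c w rv L)

/-- All bond dimensions of the train are `r + 1`.  [cite: VysotskyRakhuba2022, Prop. 4.1] -/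
theorem r_expSumTrain (c w : Fin r → K) (rv : Fin r → Bool) (L i : ℕ) :
    (expSumTrain K c w rv L).r i = r + 1 := rfl

variable {K}

/-! ### Entries of the core (the displayed block structure) -/

/-- Block `(0, 0)` of `Q_k` is `I`.  [cite: VysotskyRakhuba2022, Prop. 4.1] -/
@[simp] theorem expSumCore_zero_zero (w : Fin r → K) (rv : Fin r → Bool) (L ℓ : ℕ)
    (p : Fin 2 × Fin 2) : expSumCore K w rv L ℓ p 0 0 = blkI K p := rfl

/-- Block `(0, t+1)` of `Q_k` is `K_{t,k}` (resp. `K̄_{t,k}`).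
[cite: VysotskyRakhuba2022, Prop. 4.1] -/
@[simp] theorem expSumCore_zero_succ (w : Fin r → K) (rv : Fin r → Bool) (L ℓ : ℕ)
    (p : Fin 2 × Fin 2) (t : Fin r) :
    expSumCore K w rv L ℓ p 0 t.succ = esKflag K (rv t) (expSumQ K (w t) L ℓ) (ℓ + 1) p := rfl

/-- Blocks `(t+1, 0)` of `Q_k` vanish.  [cite: VysotskyRakhuba2022, Prop. 4.1] -/
@[simp] theorem expSumCore_succ_zero (w : Fin r → K) (rv : Fin r → Bool) (L ℓ : ℕ)
    (p : Fin 2 × Fin 2) (t : Fin r) : expSumCore K w rv L ℓ p t.succ 0 = 0 := rfl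

/-- Block `(t+1, s+1)` of `Q_k` is `M_{t,k}` (resp. `M̄_{t,k}`) on the diagonal and `0` off it.
[cite: VysotskyRakhuba2022, Prop. 4.1] -/
@[simp] theorem expSumCore_succ_succ (w : Fin r → K) (rv : Fin r → Bool) (L ℓ : ℕ)
    (p : Fin 2 × Fin 2) (t s : Fin r) :
    expSumCore K w rv L ℓ p t.succ s.succ =
      if t = s then esMflag K (rv t) (expSumQ K (w t) L ℓ) p else 0 := rfl

/-- Multiplying a bond vector into the core: component `0` picks up `I`, component `t + 1` picks up
`K_{t,k}` from the first row and `M_{t,k}` from the diagonal (bookkeeping).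
[cite: VysotskyRakhuba2022, §8 (proof of Prop. 4.1)] -/
theorem vecMul_expSumCore (v : Fin (r + 1) → K) (w : Fin r → K) (rv : Fin r → Bool) (L ℓ : ℕ)
    (p : Fin 2 × Fin 2) :
    v ᵥ* expSumCore K w rv L ℓ p = vecCons (v 0 * blkI K p) fun t =>
      v 0 * esKflag K (rv t) (expSumQ K (w t) L ℓ) (ℓ + 1) p +
        v t.succ * esMflag K (rv t) (expSumQ K (w t) L ℓ) p := by
  ext s
  refine Fin.cases ?_ (fun s => ?_) s
  · simp [Matrix.vecMul, dotProduct, Fin.sum_univ_succ]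
  · simp [Matrix.vecMul, dotProduct, Fin.sum_univ_succ, mul_ite, Finset.sum_ite_eq']

/-- `Q_1 = [I H]`: with the left boundary `e_0` the first core acts as its first row
`[I, K_{1,1}, …] = [I, H, …, H]`.  [cite: VysotskyRakhuba2022, Prop. 4.1] -/
theorem lbdry_vecMul_expSumCore_zero (w : Fin r → K) (rv : Fin r → Bool) (L : ℕ)
    (p : Fin 2 × Fin 2) :
    Pi.single (0 : Fin (r + 1)) (1 : K) ᵥ* expSumCore K w rv L 0 p =
      vecCons (blkI K p) fun _ => blkH K p := by
  rw [vecMul_expSumCore]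
  ext s
  refine Fin.cases ?_ (fun t => ?_) s
  · simp
  · simp only [cons_val_succ, Pi.single_eq_same, one_mul, Pi.single_apply, Fin.succ_ne_zero,
      if_false, zero_mul, add_zero, esKflag]
    cases rv t
    · simp [esK_one]
    · simp [esKbar_one]

/-- The second row `[·, M_{1,2}, …, M_{r,2}]` of the displayed `Q_2`: the selector `(0, 1, …, 1)`
times the core collects the diagonal blocks (so `[1 0 ⋯ 0; 0 1 ⋯ 1] ⋈ expSumCore 1` is the displayed
two-row `Q_2`).  [cite: VysotskyRakhuba2022, Prop. 4.1] -/
theorem selector_vecMul_expSumCore (w : Fin r → K) (rv : Fin r → Bool) (L ℓ : ℕ)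
    (p : Fin 2 × Fin 2) :
    vecCons (0 : K) (fun _ : Fin r => 1) ᵥ* expSumCore K w rv L ℓ p =
      vecCons 0 fun t => esMflag K (rv t) (expSumQ K (w t) L ℓ) p := by
  rw [vecMul_expSumCore]
  ext s
  refine Fin.cases ?_ (fun t => ?_) s <;> simp

/-- `Q_L = [γ_1 I + γ_2 J' + γ_3 J; α_t w_t M_{t,L}; β_t z_t M̄_{t,L}]`: the last core (site `L`,
`q_{t,L+1} = w_t`) times the right boundary, for a train with `L + 1` sites, with
`γ_1 = Σ_{¬rv} c_t + Σ_{rv} c_t w_t^{2^{L+1}}`,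
`γ_2 = Σ_{¬rv} c_t w_t + Σ_{rv} c_t w_t^{2^{L+1}−1}`,
`γ_3 = Σ_{¬rv} c_t w_t^{2^{L+1}−1} + Σ_{rv} c_t w_t`.  [cite: VysotskyRakhuba2022, Cor. 4.1] -/
theorem expSumCore_mulVec_expSumBdry (c w : Fin r → K) (rv : Fin r → Bool) (L : ℕ)
    (p : Fin 2 × Fin 2) :
    expSumCore K w rv (L + 1) L p *ᵥ expSumBdry K c w rv (L + 1) =
      vecCons
        ((∑ t, c t * w t ^ (if rv t then 2 ^ (L + 1) else 0)) * blkI K p +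
          (∑ t, c t * w t ^ (if rv t then 2 ^ (L + 1) - 1 else 1)) * blkJ' K p +
          (∑ t, c t * w t ^ (if rv t then 1 else 2 ^ (L + 1) - 1)) * blkJ K p)
        fun t => c t * w t * esMflag K (rv t) (w t) p := by
  have hq : ∀ t, expSumQ K (w t) (L + 1) L = w t := by
    intro t; simp [expSumQ]
  have hpow : ∀ x : K, x * x ^ (2 ^ (L + 1) - 2) = x ^ (2 ^ (L + 1) - 1) := by
    intro x
    rw [← pow_succ']
    congr 1
    have : 2 ≤ 2 ^ (L + 1) := by
      calc (2 : ℕ) = 2 ^ 1 := by norm_num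
        _ ≤ 2 ^ (L + 1) := Nat.pow_le_pow_right (by norm_num) (by omega)
    omega
  ext s
  simp only [Matrix.mulVec, dotProduct, Fin.sum_univ_succ]
  refine Fin.cases ?_ (fun t => ?_) s
  · simp only [expSumCore_zero_zero, expSumCore_zero_succ, expSumBdry, cons_val_zero,
      cons_val_succ, hq, Finset.sum_mul, Finset.mul_sum]
    simp only [← Finset.sum_add_distrib]
    refine Finset.sum_congr rfl fun t _ => ?_
    cases rv t
    · simp only [esKflag, if_false, esK, Bool.false_eq_true, pow_zero, pow_one]
      rw [← hpow]; ring
    · simp only [esKflag, if_true, esKbar, pow_one]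
      rw [← hpow]; ring
  · simp only [expSumCore_succ_zero, expSumCore_succ_succ, expSumBdry, cons_val_zero,
      cons_val_succ, hq, zero_mul, zero_add, ite_mul, zero_mul, Finset.sum_ite_eq, Finset.mem_univ,
      if_true]
    ring

/-! ### The transfer-matrix bookkeeping -/

/-- The bond-vector component of ONE term after `k` of `L` levels, prefix values `m, n`:
`𝟙[m ≠ n] · w^{2^{L−k}((m − n) mod 2^k − 1)}` (bookkeeping).
[cite: VysotskyRakhuba2022, §8 (proof of Prop. 4.1)] -/
def expSumTermState (w : K) (L k m n : ℕ) : K :=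
  if m = n then 0 else w ^ (2 ^ (L - k) * (cycSub (2 ^ k) m n - 1))

/-- The bond vector after `k` levels: `(𝟙[m = n]; expSumTermState_t)_t`, the digits swapped for
flagged terms (bookkeeping).  [cite: VysotskyRakhuba2022, §8 (proof of Prop. 4.1)] -/
def expSumState (w : Fin r → K) (rv : Fin r → Bool) (L k m n : ℕ) : Fin (r + 1) → K :=
  vecCons (if m = n then 1 else 0) fun t =>
    if rv t then expSumTermState (w t) L k n m else expSumTermState (w t) L k m n

/-- At `k = 0` the bond vector is the left boundary `e_0`.
[cite: VysotskyRakhuba2022, §8 (proof of Prop. 4.1)] -/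
theorem expSumState_zero (w : Fin r → K) (rv : Fin r → Bool) (L : ℕ) :
    expSumState w rv L 0 0 0 = Pi.single 0 1 := by
  ext s
  refine Fin.cases ?_ (fun t => ?_) s
  · simp [expSumState]
  · simp [expSumState, expSumTermState]

/-- ONE TERM, ONE LEVEL: `expSumTermState (k+1) (2m+a) (2n+a') = 𝟙[m = n] K_{k+1}(a, a') +
expSumTermState k m n · M_{k+1}(a, a')` with `q_{k+1} = w^{2^{L−k−1}}` — the identities
`q_{t,k}² = q_{t,k−1}` behind the displayed blocks (bookkeeping).
[cite: VysotskyRakhuba2022, §8 (proof of Prop. 4.1)] -/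
theorem expSumTermState_step (w : K) {L k m n : ℕ} (a a' : Fin 2) (hk : k < L) (hm : m < 2 ^ k)
    (hn : n < 2 ^ k) :
    expSumTermState w L (k + 1) (2 * m + a) (2 * n + a') =
      (if m = n then 1 else 0) * esK K (expSumQ K w L k) (k + 1) (a, a') +
        expSumTermState w L k m n * esM K (expSumQ K w L k) (a, a') := by
  have ha : (a : ℕ) ≤ 1 := by have := a.isLt; omega
  have ha' : (a' : ℕ) ≤ 1 := by have := a'.isLt; omega
  have hP : 2 ^ (k + 1) = 2 * 2 ^ k := by rw [pow_succ, mul_comm]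
  have hQ : 2 ^ (L - k) = 2 * 2 ^ (L - (k + 1)) := by
    rw [show L - k = L - (k + 1) + 1 by omega, pow_succ, mul_comm]
  have hPpos : 0 < 2 ^ k := Nat.two_pow_pos k
  rw [esK_apply, esM_apply]
  simp only [expSumQ, ← pow_mul]
  by_cases hmn : m = n
  · subst hmn
    by_cases haa : a = a'
    · subst haa
      simp [expSumTermState]
    · have hne : (a : ℕ) ≠ a' := fun h => haa (Fin.ext h)
      have hne' : 2 * m + (a : ℕ) ≠ 2 * m + a' := by omega
      simp only [expSumTermState, hne', if_false, if_true, one_mul, haa, cycSub_self, hP]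
      rw [show 2 ^ (L - (k + 1)) * (cycSub (2 * 2 ^ k) (2 * m + ↑a) (2 * m + ↑a') - 1) =
        2 ^ (L - (k + 1)) * ((2 * 2 ^ k - 2) * ↑a') by rw [cycSub_step_same hPpos ha ha' hne]]
      simp
  · have hb := one_le_cycSub hmn hm hn
    have hne' : 2 * m + (a : ℕ) ≠ 2 * n + a' := by omega
    simp only [expSumTermState, hmn, hne', if_false, zero_mul, zero_add, hP,
      cycSub_step hmn hm hn ha ha', ← pow_add, hQ]
    congr 1
    have e : 2 * (cycSub (2 ^ k) m n - 1) + (1 + (a : ℕ) - a') =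
        2 * cycSub (2 ^ k) m n + a - a' - 1 := by omega
    calc 2 ^ (L - (k + 1)) * (2 * cycSub (2 ^ k) m n + ↑a - ↑a' - 1)
        = 2 ^ (L - (k + 1)) * (2 * (cycSub (2 ^ k) m n - 1) + (1 + ↑a - ↑a')) := by rw [e]
      _ = 2 * 2 ^ (L - (k + 1)) * (cycSub (2 ^ k) m n - 1) +
            2 ^ (L - (k + 1)) * (1 + ↑a - ↑a') := by ring

/-- THE DIGIT STEP of the whole bond vector: `expSumState (k+1) (2m+a) (2n+a') =
expSumState k m n · Q_{k+1}(a, a')`.  [cite: VysotskyRakhuba2022, §8 (proof of Prop. 4.1)] -/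
theorem expSumState_step (w : Fin r → K) (rv : Fin r → Bool) {L k m n : ℕ} (a a' : Fin 2)
    (hk : k < L) (hm : m < 2 ^ k) (hn : n < 2 ^ k) :
    expSumState w rv L (k + 1) (2 * m + a) (2 * n + a') =
      expSumState w rv L k m n ᵥ* expSumCore K w rv L k (a, a') := by
  have ha : (a : ℕ) ≤ 1 := by have := a.isLt; omega
  have ha' : (a' : ℕ) ≤ 1 := by have := a'.isLt; omega
  rw [vecMul_expSumCore]
  ext s
  refine Fin.cases ?_ (fun t => ?_) s
  · simp only [expSumState, cons_val_zero, blkI]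
    by_cases hmn : m = n
    · subst hmn
      by_cases haa : a = a'
      · subst haa; simp
      · have hne : (a : ℕ) ≠ a' := fun h => haa (Fin.ext h)
        simp [hne, haa]
    · have : 2 * m + (a : ℕ) ≠ 2 * n + a' := by omega
      simp [this, hmn]
  · simp only [expSumState, cons_val_zero, cons_val_succ, esKflag, esMflag]
    cases rv t
    · simp only [Bool.false_eq_true, if_false]
      exact expSumTermState_step (K := K) (w t) a a' hk hm hn
    · simp only [if_true, esKbar_eq_esK_swap, esMbar_eq_esM_swap, Prod.swap_prod_mk]
      rw [show (if m = n then (1 : K) else 0) = if n = m then 1 else 0 by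
        simp only [eq_comm]]
      exact expSumTermState_step (K := K) (w t) a' a hk hn hm

/-- THE VALUE OF THE TRAIN at a pair of digit strings is the final bond vector paired with the
right boundary.  [cite: VysotskyRakhuba2022, §8 (proof of Prop. 4.1)] -/
theorem eval_expSumTrain (c w : Fin r → K) (rv : Fin r → Bool) (L : ℕ) (σ μ : Fin L → Fin 2) :
    (expSumTrain K c w rv L).eval (fun i => (σ i, μ i)) =
      expSumState w rv L L (quanticsEquiv 2 L σ) (quanticsEquiv 2 L μ) ⬝ᵥ
        expSumBdry K c w rv L := by
  rw [expSumTrain, TensorTrain.eval_uniform, ← expSumState_zero w rv L,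
    TensorTrain.vecMul_chainProd_of_digitStep' (fun ℓ p => expSumCore K w rv L ℓ p)
      (fun k m n => expSumState w rv L k m n) L
      (fun k m m' a a' hk hm hm' => expSumState_step w rv a a' hk hm hm')]

/-- THE FINAL PAIRING: `expSumState L m n · expSumBdry = Σ_t c_t w_t^{d}` resp. `w_t^{2^L − d}`,
`d = (m − n) mod 2^L` (bookkeeping).  [cite: VysotskyRakhuba2022, §8 (proof of Prop. 4.1)] -/
theorem expSumState_dotProduct_expSumBdry (c w : Fin r → K) (rv : Fin r → Bool) (L : ℕ)
    (m n : Fin (2 ^ L)) :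
    expSumState w rv L L m n ⬝ᵥ expSumBdry K c w rv L =
      ∑ t, c t * w t ^ (if rv t then 2 ^ L - ((m - n : Fin (2 ^ L)) : ℕ)
        else ((m - n : Fin (2 ^ L)) : ℕ)) := by
  rw [val_fin_sub_eq_cycSub, expSumState, expSumBdry, cons_dotProduct_cons, dotProduct]
  by_cases hmn : (m : ℕ) = n
  · have hmn' : m = n := Fin.ext hmn
    subst hmn'
    simp [expSumTermState, cycSub_self]
  · simp only [hmn, if_false, zero_mul, zero_add, expSumTermState, Nat.sub_self, pow_zero, one_mul]
    refine Finset.sum_congr rfl fun t _ => ?_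
    have hb := one_le_cycSub hmn m.isLt n.isLt
    have hne : (n : ℕ) ≠ m := fun h => hmn h.symm
    have hb' := one_le_cycSub hne n.isLt m.isLt
    cases rv t
    · simp only [Bool.false_eq_true, if_false]
      rw [mul_comm, mul_assoc, ← pow_succ', Nat.sub_add_cancel hb.1]
    · simp only [if_true]
      rw [mul_comm, mul_assoc, if_neg hne, ← pow_succ', Nat.sub_add_cancel hb'.1,
        cycSub_swap hmn m.isLt n.isLt]

/-- **PROPOSITION 4.1 / COROLLARY 4.1 (VR2022), uniform form.** The train `expSumTrain K c w rv L`
(ranks `r + 1`, cores `Q_k`) represents the circulant with first column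
`j ↦ Σ_t c_t w_t^{j}` (terms with flag `false`) `+ Σ_t c_t w_t^{2^L − j}` (flag `true`) — for
every `L ≥ 0` and over any commutative ring.  [cite: VysotskyRakhuba2022, Prop. 4.1] -/
theorem qttMatrix_expSumTrain (c w : Fin r → K) (rv : Fin r → Bool) (L : ℕ) :
    (expSumTrain K c w rv L).qttMatrix =
      Matrix.circulant fun j : Fin (2 ^ L) =>
        ∑ t, c t * w t ^ (if rv t then 2 ^ L - (j : ℕ) else (j : ℕ)) := by
  rw [TensorTrain.qttMatrix_eq_iff]
  intro σ μ
  rw [eval_expSumTrain, expSumState_dotProduct_expSumBdry, Matrix.circulant_apply]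

/-- **PROPOSITION 4.1 (VR2022).** The circulant with first column `(B_L)_j = Σ_t α_t w_t^j` is
represented by `Q_1 ⋈ ⋯ ⋈ Q_L` with the blocks `K_{t,k}, M_{t,k}` (all flags `false`).
[cite: VysotskyRakhuba2022, Prop. 4.1] -/
theorem qttMatrix_expSumTrain_prop41 (α w : Fin r → K) (L : ℕ) :
    (expSumTrain K α w (fun _ => false) L).qttMatrix =
      Matrix.circulant fun j : Fin (2 ^ L) => ∑ t, α t * w t ^ (j : ℕ) := by
  rw [qttMatrix_expSumTrain]
  simp

/-- **COROLLARY 4.1 (VR2022)** (with the corrected `K̄`, see the header).  The circulant with first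
column `(B_L)_j = Σ_{t ≤ r_1} α_t w_t^j + Σ_{t ≤ r_2} β_t z_t^{2^L − j}` is represented by the train
on the joined families (`Fin.append`; flags `false` for the `w`'s, `true` for the `z`'s), ranks
`r_1 + r_2 + 1`.  [cite: VysotskyRakhuba2022, Cor. 4.1] -/
theorem qttMatrix_expSumTrain_cor41 {r₁ r₂ : ℕ} (α w : Fin r₁ → K) (β z : Fin r₂ → K) (L : ℕ) :
    (expSumTrain K (Fin.append α β) (Fin.append w z)
        (Fin.append (fun _ : Fin r₁ => false) (fun _ : Fin r₂ => true)) L).qttMatrix =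
      Matrix.circulant fun j : Fin (2 ^ L) =>
        (∑ t, α t * w t ^ (j : ℕ)) + ∑ t, β t * z t ^ (2 ^ L - (j : ℕ)) := by
  rw [qttMatrix_expSumTrain]
  congr 1
  funext j
  rw [Fin.sum_univ_add]
  simp

/-! ### The first rank is `2` -/

/-- The first unfolding of the represented tensor has rank `≤ 2` (the paper's first rank: `Q_1 =
[I H]` is `1 × 2`): its rows are spanned by `I(p)` and `H(p)`.
[cite: VysotskyRakhuba2022, Prop. 4.1] -/
theorem rank_unfolding_expSumTrain_first_le {K : Type u} [Field K] {r : ℕ} (c w : Fin r → K)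
    (rv : Fin r → Bool) (L m : ℕ) (h : 1 + m = L) :
    (Matrix.of fun (s : Fin 1 → Fin 2 × Fin 2) (t : Fin m → Fin 2 × Fin 2) =>
        (expSumTrain K c w rv L).eval (fun i => Fin.append s t (i.cast h.symm))).rank ≤ 2 := by
  rw [expSumTrain]
  refine TensorTrain.rank_unfolding_uniform_le_of_dotProduct _ _ _ 1 m h
    (fun s => ![blkI K (s 0), blkH K (s 0)])
    (fun t => ![(TensorTrain.chainProd (fun ℓ => fun p => expSumCore K w rv L (1 + ℓ) p) m t *ᵥ
        expSumBdry K c w rv L) 0,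
      ∑ u : Fin r, (TensorTrain.chainProd (fun ℓ => fun p => expSumCore K w rv L (1 + ℓ) p) m t *ᵥ
        expSumBdry K c w rv L) u.succ]) fun s t => ?_
  rw [TensorTrain.chainProd, TensorTrain.chainProd, Matrix.one_mul]
  rw [show s (Fin.last 0) = s 0 from rfl, lbdry_vecMul_expSumCore_zero, cons_dotProduct, dotProduct]
  simp only [vecHead, vecTail, Matrix.dotProduct_cons, Function.comp_def, Finset.mul_sum]
  simp

/-! ### Dedup bridge -/

/-- The cyclic permutation matrix `P` of [VysotskyRakhuba2022, §4] (`cyclicShiftP`, ones on the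
subdiagonal and in the top right corner) is the transpose of the directed-cycle adjacency matrix
`cycShift` (`B_{ij} = 𝟙[j = i + 1]`) of `Literature.Combinatorics.SimpleGraph` — both are the
circulant `circ(e_1)` up to transpose (bridge between the two in-tree renderings).
[cite: VysotskyRakhuba2022, §4] -/
theorem cyclicShiftP_eq_transpose_cycShift (N : ℕ) [NeZero N] :
    cyclicShiftP K N = (Literature.Combinatorics.SimpleGraph.cycShift K N)ᵀ := by
  rw [cyclicShiftP_eq_circulant, Literature.LinearAlgebra.Matrix.cycShift_transpose_eq_circulant]

end Train

end Literature.LinearAlgebra.TensorNetworks
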